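import Summits.Ventures.LatticeQCDFlow.Scaling.MinNetworkMonotone

/-!
HONEST FRAMING: exact (Metropolis-corrected) sampling algorithms for lattice gauge theory; figures
of merit are autocorrelation/cost numbers at stated couplings and volumes; no continuum-physics
claim.

# MinNetworkGreen — TWO MORE FACTS OF THE POTENTIAL THEORY OF THE WEIGHTED MIN-CONDUCTANCE NETWORKS OF FILES 24–25: GREEN'S RECIPROCITY `Σ_A ψ·(Lφ) = Σ_A φ·(Lψ)` (SO THE GREEN
# KERNEL IS SYMMETRIC) AND THE MAXIMUM PRINCIPLE (THE POTENTIAL OF A POINT SOURCE IS MAXIMAL AT THE SOURCE) (lean-2 GEN-38, ours)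

Venture-side (OURS).  Cell `lqcd-flow` (pub-lqcd), unit `pub-lqcd-lean-2-g38`, 2026-08-30.  Chapter W, file 30 (a complement to files 24–25 for later users of the class).  Setting of file 24:
`(L_{A,ρ}φ)(v) = κN_vρ_vφ(v) + βΣ_{u∈A∖v}N_uN_v·min(ρ_u,ρ_v)(φ(v) − φ(u))` (hypothesis-equation).  `minNet_reciprocity`: for any `φ, ψ`, `Σ_{v∈A}ψ(v)(Lφ)(v) = Σ_{v∈A}φ(v)(Lψ)(v)` (the edge
weights are symmetric); hence two potentials `Lφ = f`, `Lψ = f'` satisfy `Σψf = Σφf'` (`minNet_green_symm`; with point sources: `g(i,j) = g(j,i)`).  `minNet_le_source`: for a non-negative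
source supported at `i ∈ A` (`f(v) = 0` for `v ≠ i`), weights and depths positive, `κ > 0`, `β ≥ 0`, the potential satisfies `φ(v) ≤ φ(i)` on `A` (at a maximiser `v ≠ i` the equation
forces `κN_vρ_vφ(v) ≤ 0`).  In chain terms (files 20, 26): the discounted occupation density `G_σ(·,i)/m(i)` of the tagged hub chain is symmetric and maximal at the source.
Hypothesis-equations, no definitions.

## What is proved

* `minNet_reciprocity`, `minNet_green_symm`, `minNet_le_source`.

Literature grade (cell rule): OWN, elementary; nothing cited as a fact; no new bib keys.
-/

open Finset

namespace Summit.Ventures.LatticeQCDFlow.Scaling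

section MinNetGreen
variable {ι : Type*} [DecidableEq ι]
variable {N : ι → ℝ} {β κ : ℝ} {L : Finset ι → (ι → ℝ) → (ι → ℝ) → ι → ℝ}

/-- **Green's reciprocity:** `Σ_{v∈A} ψ(v)(Lφ)(v) = Σ_{v∈A} φ(v)(Lψ)(v)`. [ours] -/
theorem minNet_reciprocity (hL : ∀ A ρ φ v, L A ρ φ v = κ * (N v * ρ v) * φ v + β * ∑ u ∈ A.erase v, N u * N v * min (ρ u) (ρ v) * (φ v - φ u))
    (A : Finset ι) (ρ φ ψ : ι → ℝ) : ∑ v ∈ A, ψ v * L A ρ φ v = ∑ v ∈ A, φ v * L A ρ ψ v := by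
  -- write the edge sums over ordered pairs of `A × A` with a vanishing diagonal
  have hoff : ∀ (χ ω : ι → ℝ) (v : ι), v ∈ A → ∑ u ∈ A.erase v, N u * N v * min (ρ u) (ρ v) * (χ v - χ u) * ω v
      = ∑ u ∈ A, N u * N v * min (ρ u) (ρ v) * (χ v - χ u) * ω v := by
    intro χ ω v hv
    rw [← Finset.sum_erase_add A _ hv]; simp
  have e : ∀ (χ ω : ι → ℝ), ∑ v ∈ A, ω v * L A ρ χ v
      = κ * ∑ v ∈ A, N v * ρ v * (χ v * ω v) + β * ∑ v ∈ A, ∑ u ∈ A, N u * N v * min (ρ u) (ρ v) * (χ v - χ u) * ω v := by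
    intro χ ω
    rw [mul_sum, mul_sum, ← sum_add_distrib]
    refine sum_congr rfl fun v hv => ?_
    rw [hL, ← hoff χ ω v hv, mul_add, mul_sum, mul_sum, mul_sum]
    congr 1
    · ring
    · exact sum_congr rfl fun u _ => by ring
  rw [e φ ψ, e ψ φ]
  congr 1
  · congr 1; exact sum_congr rfl fun v _ => by ring
  · congr 1
    -- `Σ_vΣ_u w_{uv}(χ_v − χ_u)ω_v` is symmetric in `(χ, ω)`: split and swap the double sum
    have hsplit : ∀ (χ ω : ι → ℝ), ∑ v ∈ A, ∑ u ∈ A, N u * N v * min (ρ u) (ρ v) * (χ v - χ u) * ω v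
        = ∑ v ∈ A, ∑ u ∈ A, N u * N v * min (ρ u) (ρ v) * (χ v * ω v) - ∑ v ∈ A, ∑ u ∈ A, N u * N v * min (ρ u) (ρ v) * (χ u * ω v) := by
      intro χ ω; rw [← sum_sub_distrib]; refine sum_congr rfl fun v _ => ?_; rw [← sum_sub_distrib]; exact sum_congr rfl fun u _ => by ring
    rw [hsplit φ ψ, hsplit ψ φ]
    have h1 : ∑ v ∈ A, ∑ u ∈ A, N u * N v * min (ρ u) (ρ v) * (φ v * ψ v) = ∑ v ∈ A, ∑ u ∈ A, N u * N v * min (ρ u) (ρ v) * (ψ v * φ v) :=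
      sum_congr rfl fun v _ => sum_congr rfl fun u _ => by ring
    have h2 : ∑ v ∈ A, ∑ u ∈ A, N u * N v * min (ρ u) (ρ v) * (φ u * ψ v) = ∑ v ∈ A, ∑ u ∈ A, N u * N v * min (ρ u) (ρ v) * (ψ u * φ v) := by
      rw [sum_comm]; exact sum_congr rfl fun v _ => sum_congr rfl fun u _ => by rw [min_comm]; ring
    rw [h1, h2]

/-- **Symmetry of the Green kernel:** potentials `Lφ = f`, `Lψ = f'` on `A` satisfy `Σ_{v∈A}ψ(v)f(v) = Σ_{v∈A}φ(v)f'(v)`. [ours] -/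
theorem minNet_green_symm (hL : ∀ A ρ φ v, L A ρ φ v = κ * (N v * ρ v) * φ v + β * ∑ u ∈ A.erase v, N u * N v * min (ρ u) (ρ v) * (φ v - φ u))
    {A : Finset ι} {ρ φ ψ f f' : ι → ℝ} (hφ : ∀ v ∈ A, L A ρ φ v = f v) (hψ : ∀ v ∈ A, L A ρ ψ v = f' v) :
    ∑ v ∈ A, ψ v * f v = ∑ v ∈ A, φ v * f' v := by
  calc ∑ v ∈ A, ψ v * f v = ∑ v ∈ A, ψ v * L A ρ φ v := sum_congr rfl fun v hv => by rw [hφ v hv]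
    _ = ∑ v ∈ A, φ v * L A ρ ψ v := minNet_reciprocity hL A ρ φ ψ
    _ = ∑ v ∈ A, φ v * f' v := sum_congr rfl fun v hv => by rw [hψ v hv]

/-- **The maximum principle:** for a non-negative source supported at `i`, the potential is maximal at `i`: `φ(v) ≤ φ(i)` on `A`. [ours] -/
theorem minNet_le_source (hL : ∀ A ρ φ v, L A ρ φ v = κ * (N v * ρ v) * φ v + β * ∑ u ∈ A.erase v, N u * N v * min (ρ u) (ρ v) * (φ v - φ u))
    (hκ : 0 < κ) (hβ : 0 ≤ β) {A : Finset ι} (hN : ∀ v ∈ A, 0 < N v) {ρ f φ : ι → ℝ} (hρ : ∀ v ∈ A, 0 < ρ v)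
    {i : ι} (hi : i ∈ A) (hf0 : ∀ v ∈ A, 0 ≤ f v) (hfi : ∀ v ∈ A, v ≠ i → f v = 0) (hφ : ∀ v ∈ A, L A ρ φ v = f v) :
    ∀ v ∈ A, φ v ≤ φ i := by
  have hnn : ∀ v ∈ A, 0 ≤ φ v := minNet_nonneg hL hκ hβ A.card A rfl hN ρ f φ hρ hf0 hφ
  obtain ⟨m, hm, hmax⟩ := exists_max_image A φ ⟨i, hi⟩
  by_cases hmi : φ m ≤ φ i
  · exact fun v hv => (hmax v hv).trans hmi
  · -- a maximiser `m ≠ i` with `φ m > φ i ≥ 0`: the equation at `m` gives `κN_mρ_mφ(m) ≤ 0`, contradiction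
    exfalso
    push Not at hmi
    have hne : m ≠ i := fun e => by rw [e] at hmi; exact lt_irrefl _ hmi
    have heq := hφ m hm
    rw [hL, hfi m hm hne] at heq
    have hedge : 0 ≤ ∑ u ∈ A.erase m, N u * N m * min (ρ u) (ρ m) * (φ m - φ u) :=
      sum_nonneg fun u hu => mul_nonneg (mul_nonneg (mul_nonneg (hN u (mem_of_mem_erase hu)).le (hN m hm).le)
        (le_min (hρ u (mem_of_mem_erase hu)).le (hρ m hm).le)) (sub_nonneg.mpr (hmax u (mem_of_mem_erase hu)))
    have hpos : 0 < κ * (N m * ρ m) * φ m := mul_pos (mul_pos hκ (mul_pos (hN m hm) (hρ m hm))) (lt_of_le_of_lt (hnn i hi) hmi)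
    nlinarith [mul_nonneg hβ hedge]

end MinNetGreen

end Summit.Ventures.LatticeQCDFlow.Scaling
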